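import Mathlib

/-!
# LatitudeDirectors — coplanar directors with a common non-zero tilt span at most two lines
# (STAGING; nogo gen 24; `SIEVELD.md` §3.4b (8f) corollary (T1), the 'latitude-circle' step)

search for candidate a priori estimates; no regularity claim.

(T1) of SIEVELD §3.4b (8f) reads: "κ_q(e) = 0 iff λ₁ ≡ 1 on the cross-section iff the directors around `e` are
coplanar (every θ_i > 0 everywhere; λ₁(Σθ_iK_i) = 1 iff some unit v has v ⊥ n_i ∀ i) iff s_e = 0: for s_e > 0 the
director lines lie on the two latitude circles {n·τ = ±s_e}, which a plane through 0 meets in at most two antipodal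
pairs, and a junction with only two director lines is the two-well X, which violates the loop law".  The pointwise
criterion 'λ₁ = 1 ⟺ common unit normal' is `SharpClass.DirectorForm.lam1_well_mix_eq_one_iff` (staged file
`DirectorFormTension`, filing request #7) and the X junction's violation of the loop law is
`SharpClass.JunctionSectors.no_X_junction` (staged, #6, sector form).  THIS FILE is the LATITUDE-CIRCLE STEP in
between, as pure vector algebra in `ℝ³` with Mathlib's cross product `⨯₃` (`cross_cross_eq_smul_sub_smul'`):

* `eq_smul_of_cross_eq_zero` — `v ≠ 0`, `v ⨯₃ τ = 0` ⇒ `τ = ((v·τ)/(v·v)) • v`; hence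
  `dotProduct_eq_zero_of_parallel`: if `v ≠ 0` is parallel to the edge tangent `τ`, NO director `n ⊥ v` has a
  non-zero tilt `n·τ`;
* `eq_smul_cross_of_orthogonal` — `d ⊥ v`, `d ⊥ τ`, `v ⨯₃ τ ≠ 0` ⇒ `d = t • (v ⨯₃ τ)` (the normal line of the
  plane spanned by `v, τ`);
* `latitude_two_points` — unit vectors `n ⊥ v` (`v ≠ 0`) with the SAME tilt `n·τ = s ≠ 0` number at most two:
  among any three of them, two coincide (they lie on the line `n₁ + ℝ(v ⨯₃ τ)`, which meets the unit sphere twice);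
* `latitude_two_lines` — unit vectors `n ⊥ v` with `(n·τ)² = s²`, `s ≠ 0`, span at most two LINES: among any
  three, two coincide or are antipodal;
* `coplanar_tilted_directors_two_lines` — the (T1) step for a director family `n : ι → ℝ³` (unit, common tilt
  `(n_i·τ)² = s²` with `s ≠ 0`) admitting a common normal `v ≠ 0`: the family takes at most two values up to
  sign, `∃ a b, ∀ i, n i = a ∨ n i = −a ∨ n i = b ∨ n i = −b` — around a tilted junction line, a coplanar
  director set is (at most) the two-well X.
NOT in Lean here: that the X violates the loop law in the `3 × 3` wall formalism (sector form: `no_X_junction`),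
criterion (E), THEOREM T, anything about Navier–Stokes.  No verdict of the cell changes. [ours; folklore vector
algebra]
-/

noncomputable section

open Matrix

namespace Summit.NavierStokesRegularity.FunctionalMining.SharpClass.Latitude

variable {v τ : Fin 3 → ℝ} {s : ℝ}

/-- If `v ≠ 0` and `v ⨯₃ τ = 0` then `τ` is the multiple `((v·τ)/(v·v)) v` of `v`
(from `v ⨯₃ (v ⨯₃ τ) = (v·τ)v − (v·v)τ`). [folklore] -/
theorem eq_smul_of_cross_eq_zero (hv : v ≠ 0) (h : v ⨯₃ τ = 0) :
    τ = ((v ⬝ᵥ τ) / (v ⬝ᵥ v)) • v := by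
  have hvv : v ⬝ᵥ v ≠ 0 := fun h0 => hv (dotProduct_self_eq_zero.mp h0)
  have key := cross_cross_eq_smul_sub_smul' v v τ
  rw [h, map_zero, eq_comm, sub_eq_zero] at key
  rw [div_eq_inv_mul, mul_smul, key, smul_smul, inv_mul_cancel₀ hvv, one_smul]

/-- If the common normal `v ≠ 0` is parallel to the edge tangent `τ`, every director `n ⊥ v` has ZERO tilt
`n·τ = 0` — so a non-zero common tilt forces `v ⨯₃ τ ≠ 0`. [folklore] -/
theorem dotProduct_eq_zero_of_parallel (hv : v ≠ 0) (h : v ⨯₃ τ = 0) {n : Fin 3 → ℝ}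
    (hn : n ⬝ᵥ v = 0) : n ⬝ᵥ τ = 0 := by
  rw [eq_smul_of_cross_eq_zero hv h, dotProduct_smul, hn, smul_zero]

/-- A vector orthogonal to both `v` and `τ` is a multiple of `v ⨯₃ τ` when `v ⨯₃ τ ≠ 0`: the orthogonal
complement of the plane `span{v, τ}` is the line `ℝ(v ⨯₃ τ)`. [folklore] -/
theorem eq_smul_cross_of_orthogonal {d : Fin 3 → ℝ} (hdv : d ⬝ᵥ v = 0) (hdτ : d ⬝ᵥ τ = 0)
    (hu : v ⨯₃ τ ≠ 0) :
    d = (((v ⨯₃ τ) ⬝ᵥ d) / ((v ⨯₃ τ) ⬝ᵥ (v ⨯₃ τ))) • (v ⨯₃ τ) := by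
  have huu : (v ⨯₃ τ) ⬝ᵥ (v ⨯₃ τ) ≠ 0 := fun h0 => hu (dotProduct_self_eq_zero.mp h0)
  have h1 : d ⨯₃ (v ⨯₃ τ) = 0 := by
    rw [cross_cross_eq_smul_sub_smul', hdτ, dotProduct_comm, hdv, zero_smul, zero_smul, sub_zero]
  have h2 : (v ⨯₃ τ) ⨯₃ d = 0 := by rw [← cross_anticomm, h1, neg_zero]
  have key := cross_cross_eq_smul_sub_smul' (v ⨯₃ τ) (v ⨯₃ τ) d
  rw [h2, map_zero, eq_comm, sub_eq_zero] at key
  rw [div_eq_inv_mul, mul_smul, key, smul_smul, inv_mul_cancel₀ huu, one_smul]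

/-- **One latitude circle meets a plane in at most two points.** Unit vectors orthogonal to `v ≠ 0` with the
SAME tilt `n·τ = s ≠ 0` number at most two: among any three of them two coincide.  (They lie on the line
`n₁ + ℝ(v ⨯₃ τ)`, and `|n₁ + t(v ⨯₃ τ)|² = 1` is `t(2 n₁·(v ⨯₃ τ) + t|v ⨯₃ τ|²) = 0`.) [ours; folklore] -/
theorem latitude_two_points (hv : v ≠ 0) (hs : s ≠ 0) {n₁ n₂ n₃ : Fin 3 → ℝ}
    (h₁ : n₁ ⬝ᵥ n₁ = 1) (h₂ : n₂ ⬝ᵥ n₂ = 1) (h₃ : n₃ ⬝ᵥ n₃ = 1)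
    (hv₁ : n₁ ⬝ᵥ v = 0) (hv₂ : n₂ ⬝ᵥ v = 0) (hv₃ : n₃ ⬝ᵥ v = 0)
    (ht₁ : n₁ ⬝ᵥ τ = s) (ht₂ : n₂ ⬝ᵥ τ = s) (ht₃ : n₃ ⬝ᵥ τ = s) :
    n₁ = n₂ ∨ n₁ = n₃ ∨ n₂ = n₃ := by
  by_cases hu : v ⨯₃ τ = 0
  · exfalso; apply hs; rw [← ht₁]; exact dotProduct_eq_zero_of_parallel hv hu hv₁
  have huu : (v ⨯₃ τ) ⬝ᵥ (v ⨯₃ τ) ≠ 0 := fun h0 => hu (dotProduct_self_eq_zero.mp h0)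
  -- every point of the circle is `n₁ + t (v ⨯₃ τ)` with `t (2 n₁·u + t u·u) = 0`
  have param : ∀ {m : Fin 3 → ℝ}, m ⬝ᵥ m = 1 → m ⬝ᵥ v = 0 → m ⬝ᵥ τ = s →
      ∃ t : ℝ, m = n₁ + t • (v ⨯₃ τ) ∧
        t * (2 * (n₁ ⬝ᵥ (v ⨯₃ τ)) + t * ((v ⨯₃ τ) ⬝ᵥ (v ⨯₃ τ))) = 0 := by
    intro m hm hmv hmt
    have hd := eq_smul_cross_of_orthogonal (v := v) (τ := τ) (d := m - n₁)
      (by rw [sub_dotProduct, hmv, hv₁, sub_zero]) (by rw [sub_dotProduct, hmt, ht₁, sub_self]) hu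
    obtain ⟨c, hc⟩ : ∃ c : ℝ, m - n₁ = c • (v ⨯₃ τ) := ⟨_, hd⟩
    have e : m = n₁ + c • (v ⨯₃ τ) := eq_add_of_sub_eq' hc
    refine ⟨c, e, ?_⟩
    have hm' := hm
    rw [e] at hm'
    simp only [add_dotProduct, dotProduct_add, smul_dotProduct, dotProduct_smul, smul_eq_mul] at hm'
    linear_combination hm' - h₁ - c * dotProduct_comm (v ⨯₃ τ) n₁
  obtain ⟨t₂, e₂, q₂⟩ := param h₂ hv₂ ht₂
  obtain ⟨t₃, e₃, q₃⟩ := param h₃ hv₃ ht₃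
  rcases mul_eq_zero.mp q₂ with ht2 | ht2
  · left; rw [e₂, ht2, zero_smul, add_zero]
  rcases mul_eq_zero.mp q₃ with ht3 | ht3
  · right; left; rw [e₃, ht3, zero_smul, add_zero]
  right; right
  have h23 : t₂ = t₃ := by
    have h0 : (t₂ - t₃) * ((v ⨯₃ τ) ⬝ᵥ (v ⨯₃ τ)) = 0 := by linear_combination ht2 - ht3
    rcases mul_eq_zero.mp h0 with h | h
    · exact sub_eq_zero.mp h
    · exact absurd h huu
  rw [e₂, e₃, h23]

/-- Sign bookkeeping: `m = ±n`, `m' = ±n'` and `m = m'` give `n = ±n'`. [ours, bookkeeping] -/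
theorem eq_or_eq_neg_of_sign {m n m' n' : Fin 3 → ℝ} (h : m = n ∨ m = -n) (h' : m' = n' ∨ m' = -n')
    (e : m = m') : n = n' ∨ n = -n' := by
  rcases h with rfl | rfl <;> rcases h' with rfl | rfl
  · exact Or.inl e
  · exact Or.inr e
  · exact Or.inr (neg_eq_iff_eq_neg.mp e)
  · exact Or.inl (neg_injective e)

/-- Flip to the upper latitude circle: a unit `n ⊥ v` with `(n·τ)² = s²` has a representative `m = ±n` with
`m·τ = s` (still unit and `⊥ v`). [ours, bookkeeping] -/
theorem exists_flip {n : Fin 3 → ℝ} (hn : n ⬝ᵥ n = 1) (hnv : n ⬝ᵥ v = 0) (hnt : (n ⬝ᵥ τ) ^ 2 = s ^ 2) :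
    ∃ m : Fin 3 → ℝ, (m = n ∨ m = -n) ∧ m ⬝ᵥ m = 1 ∧ m ⬝ᵥ v = 0 ∧ m ⬝ᵥ τ = s := by
  rcases sq_eq_sq_iff_eq_or_eq_neg.mp hnt with h | h
  · exact ⟨n, Or.inl rfl, hn, hnv, h⟩
  · exact ⟨-n, Or.inr rfl, by rw [neg_dotProduct, dotProduct_neg, neg_neg, hn],
      by rw [neg_dotProduct, hnv, neg_zero], by rw [neg_dotProduct, h, neg_neg]⟩

/-- **Two latitude circles meet a plane in at most two antipodal pairs.** Unit vectors `n ⊥ v` (`v ≠ 0`) with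
`(n·τ)² = s²`, `s ≠ 0`, span at most two LINES: among any three of them, two coincide or are antipodal.
[ours; folklore] -/
theorem latitude_two_lines (hv : v ≠ 0) (hs : s ≠ 0) {n₁ n₂ n₃ : Fin 3 → ℝ}
    (h₁ : n₁ ⬝ᵥ n₁ = 1) (h₂ : n₂ ⬝ᵥ n₂ = 1) (h₃ : n₃ ⬝ᵥ n₃ = 1)
    (hv₁ : n₁ ⬝ᵥ v = 0) (hv₂ : n₂ ⬝ᵥ v = 0) (hv₃ : n₃ ⬝ᵥ v = 0)
    (ht₁ : (n₁ ⬝ᵥ τ) ^ 2 = s ^ 2) (ht₂ : (n₂ ⬝ᵥ τ) ^ 2 = s ^ 2) (ht₃ : (n₃ ⬝ᵥ τ) ^ 2 = s ^ 2) :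
    (n₁ = n₂ ∨ n₁ = -n₂) ∨ (n₁ = n₃ ∨ n₁ = -n₃) ∨ (n₂ = n₃ ∨ n₂ = -n₃) := by
  obtain ⟨m₁, s₁, k₁, w₁, u₁⟩ := exists_flip h₁ hv₁ ht₁
  obtain ⟨m₂, s₂, k₂, w₂, u₂⟩ := exists_flip h₂ hv₂ ht₂
  obtain ⟨m₃, s₃, k₃, w₃, u₃⟩ := exists_flip h₃ hv₃ ht₃
  rcases latitude_two_points hv hs k₁ k₂ k₃ w₁ w₂ w₃ u₁ u₂ u₃ with e | e | e
  · exact Or.inl (eq_or_eq_neg_of_sign s₁ s₂ e)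
  · exact Or.inr (Or.inl (eq_or_eq_neg_of_sign s₁ s₃ e))
  · exact Or.inr (Or.inr (eq_or_eq_neg_of_sign s₂ s₃ e))

/-- **(T1), latitude-circle step.** A director family `n : ι → ℝ³` of unit vectors with a COMMON NON-ZERO TILT
(`(n_i·τ)² = s²`, `s ≠ 0`) that is COPLANAR (a common normal `v ≠ 0`, `n_i ⊥ v` for all `i`) takes at most two
values up to sign: around a tilted junction line a coplanar director set is at most the two-well X.
[ours] -/
theorem coplanar_tilted_directors_two_lines {ι : Type*} (n : ι → Fin 3 → ℝ) (hv : v ≠ 0) (hs : s ≠ 0)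
    (hunit : ∀ i, n i ⬝ᵥ n i = 1) (hperp : ∀ i, n i ⬝ᵥ v = 0) (htilt : ∀ i, (n i ⬝ᵥ τ) ^ 2 = s ^ 2) :
    ∃ a b : Fin 3 → ℝ, ∀ i, n i = a ∨ n i = -a ∨ n i = b ∨ n i = -b := by
  classical
  by_cases hex : ∃ i j, ¬ (n i = n j ∨ n i = -n j)
  · obtain ⟨i, j, hij⟩ := hex
    refine ⟨n i, n j, fun k => ?_⟩
    rcases latitude_two_lines hv hs (hunit i) (hunit j) (hunit k) (hperp i) (hperp j) (hperp k)
        (htilt i) (htilt j) (htilt k) with e | e | e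
    · exact absurd e hij
    · rcases e with e | e
      · exact Or.inl e.symm
      · exact Or.inr (Or.inl (by rw [e, neg_neg]))
    · rcases e with e | e
      · exact Or.inr (Or.inr (Or.inl e.symm))
      · exact Or.inr (Or.inr (Or.inr (by rw [e, neg_neg])))
  · push Not at hex
    by_cases hne : Nonempty ι
    · obtain ⟨i₀⟩ := hne
      refine ⟨n i₀, n i₀, fun k => ?_⟩
      rcases hex i₀ k with e | e
      · exact Or.inl e.symm
      · exact Or.inr (Or.inl (by rw [e, neg_neg]))
    · exact ⟨0, 0, fun k => absurd ⟨k⟩ hne⟩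

/-- Sharpness: two lines ARE attained — in the plane `x = 0` (normal `v = e₀`) with tangent `τ = e₂` and tilt
`s = 1/2`, the four unit vectors `(0, ±√3/2, ±1/2)` are coplanar directors with common tilt `1/2`. [ours] -/
example : let a : Fin 3 → ℝ := ![0, Real.sqrt 3 / 2, 1 / 2]
    let b : Fin 3 → ℝ := ![0, -(Real.sqrt 3 / 2), 1 / 2]
    a ⬝ᵥ a = 1 ∧ b ⬝ᵥ b = 1 ∧ a ⬝ᵥ ![1, 0, 0] = 0 ∧ b ⬝ᵥ ![1, 0, 0] = 0 ∧
      (a ⬝ᵥ ![0, 0, 1]) ^ 2 = (1 / 2 : ℝ) ^ 2 ∧ (b ⬝ᵥ ![0, 0, 1]) ^ 2 = (1 / 2 : ℝ) ^ 2 ∧ a ≠ b ∧ a ≠ -b := by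
  have h3 : Real.sqrt 3 * Real.sqrt 3 = 3 := Real.mul_self_sqrt (by norm_num)
  have hpos : 0 < Real.sqrt 3 := Real.sqrt_pos.mpr (by norm_num)
  refine ⟨?_, ?_, ?_, ?_, ?_, ?_, ?_, ?_⟩
  · simp [dotProduct, Fin.sum_univ_three]; nlinarith [h3]
  · simp [dotProduct, Fin.sum_univ_three]; nlinarith [h3]
  · simp [dotProduct, Fin.sum_univ_three]
  · simp [dotProduct, Fin.sum_univ_three]
  · simp [dotProduct, Fin.sum_univ_three]
  · simp [dotProduct, Fin.sum_univ_three]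
  · intro h; have := congr_fun h 1; simp at this; linarith
  · intro h; have := congr_fun h 2; simp at this; linarith

end Summit.NavierStokesRegularity.FunctionalMining.SharpClass.Latitude

end
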